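import Summits.Ventures.HSemireg.Mod4CarrierMiddleDegree
import Summits.Ventures.HSemireg.WedgeWeilMirror
import Summits.Ventures.HSemireg.WedgeWeilPurityOneSided

/-!
# Venture HSemireg — MOD-4 line: THEOREM R_f's ONE-SIDED column (one W-coordinate `0`) ON THE p4 CARRIER, BOTH SIDES —
# the `b`-side (`v = f + b·w₋`) by the pair half-swap `σκ`, and the upper / middle degrees of the `a`-side (`v = f + a·w₊`)

HONEST FRAMING. Part of the Lean index of the computation cell `pub-hsemireg` (widening group W3, seat w3-mod4-1 gen 7; file of
record `HOME/widen/W3/MOD4-OFFSPLIT-w3mod4.md` §11.1′ (P1)/(P2), §12).  Finite-dimensional exterior algebra over a field ONLY (th-7's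
transposed wedge model `⋀(K^{4n})` and p4's carrier of Weil type `(n,n)`): no abelian variety, no sheaf, no Ext group, no semiregularity
map; nothing here says that HC, HC_CM or HC_AV holds; no Literature fact is declared or used.  WHAT IS PROVED (proof-only):
(1) MODEL, `b`-SIDE BY SYMMETRY: an algebra automorphism of `⋀` permuting the generators preserves `Λ^m` and the rank of `θ ↦ θ ∧ v ∣ Λ^m`
(`map_algEquiv_Hom_univ`, `finrank_range_wedge_algEquiv`); the half-swap `κ = finAddFlip` of the `2n` pairs carries the block `G₊` (first `n`
pairs) onto `G₋` (`map_dup_finAddFlip_Dm`), so th-7's pair symmetry `σκ` (`σκ_f : σ_κ f = sgn κ · f`, `algEquiv_B`) carries `f + b·w₋` to a unit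
multiple of an `a`-side vector `f + a′·w₊`; hence th-7's one-sided theorems `weilRank_nn_one` / `weilRank_nn_one_dual` hold VERBATIM for the
`b`-side: `weilRank_nn_low` (`m + 1 ≤ n`), `weilRank_nn_low_dual` (`m + m′ = 2n`, `m′ + 1 ≤ n`) — MOD4-OFFSPLIT §11.1′ (P2)'s «kernel by symmetry»
made a kernel theorem.  (2) CARRIER: by seat g6's EXACT transport `finrank_S_eq_model_nn` the one-sided column of THEOREM R_f is ON THE p4 CARRIER in
every degree `1 ≤ k ≤ 2n − 1`, for BOTH one-sided classes `Ecl q (2n) + a·w₊` and `Ecl q (2n) + b·w₋`: lower side degrees (`finrank_S_weil_nn_low`;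
the `a`-side is p4's `WeilCarrier.finrank_S_weil_nn_one`), upper side degrees (`finrank_S_weil_nn_one_dual`, `finrank_S_weil_nn_low_dual`:
`dim S_k + C(n,k′)·r_{k′} = C(2n,k′) + C(2n,k′)·r_{k′}`), and the middle degree (`finrank_S_weil_nn_one_middle`, `finrank_S_weil_nn_low_middle`:
`dim S_n + 2·r_n + C(2n,n) = C(2n,n)·r_n + 2·C(2n,n) + rank(H_n(q) Ω_n H_n(q))`, th-7's `weilPurity_oneSided_b_zero` / `_a_zero` transported).
READING (dictionary NOT asserted in Lean; MOD4-OFFSPLIT §10.2 «one W-coordinate 0»): `R_k = (r_k + 1)C(2n,k) − r_kC(n,k)` (`k ≠ n`, palindromic) and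
`R_n = r_n(C(2n,n) − 2) + C(2n,n) + rank(H_n Ω_n H_n)`, whichever of the two Weil coordinates vanishes.
All statements and proofs: w3-mod4-1 g7 (2026-08-24).  Namespace `Summit.Ventures.HSemireg.Mod4Carrier`.
References: [BuchweitzFlenner2008HH] Prop. 6.4.4 (why these operators); [BourbakiAlgebre1a3] Ch. III §7, §11 no. 9.
-/

open Module

namespace Summit.Ventures.HSemireg.Mod4Carrier

/-! ### 1. Model: algebra automorphisms permuting generators preserve wedge ranks; the `b`-side by the half-swap -/

section Model

open Summit.Ventures.HSemireg.Wedge Summit.Ventures.HSemireg.Wedge.Hankel Summit.Ventures.HSemireg.Wedge.Weil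
open Summit.Ventures.HSemireg.Wedge.WeilPurity

variable (K : Type*) [Field K] {N : ℕ}

/-- an algebra automorphism of `⋀(K^{2N})` permuting the generators maps the degree-`m` part `Λ^m` ONTO itself.
[cite: BourbakiAlgebre1a3, Ch. III §7 no. 1] -/
lemma map_algEquiv_Hom_univ (φ : HT K (In N) ≃ₐ[K] HT K (In N)) (π : Equiv.Perm (In N))
    (hφ : ∀ i, φ (gx K i) = gx K (π i)) (m : ℕ) :
    (Hom K (In N) Finset.univ m).map φ.toLinearMap = Hom K (In N) Finset.univ m := by
  have hφ' : ∀ i, φ.symm (gx K i) = gx K (π.symm i) := fun i => by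
    have h := hφ (π.symm i)
    rw [Equiv.apply_symm_apply] at h
    rw [← h, AlgEquiv.symm_apply_apply]
  apply le_antisymm
  · rw [Hom_eq_Sp]
    exact map_algEquiv_Sp_le K φ π hφ fun t ht => ⟨Finset.subset_univ _, by rw [Finset.card_map, ht.2]⟩
  · intro y hy
    have h1 : φ.symm y ∈ Hom K (In N) Finset.univ m := by
      rw [Hom_eq_Sp] at hy ⊢
      exact map_algEquiv_Sp_le K φ.symm π.symm hφ' (fun t ht => ⟨Finset.subset_univ _, by rw [Finset.card_map, ht.2]⟩)
        (Submodule.mem_map_of_mem hy)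
    have : y = φ.toLinearMap (φ.symm y) := by rw [AlgEquiv.toLinearMap_apply, AlgEquiv.apply_symm_apply]
    rw [this]
    exact Submodule.mem_map_of_mem h1

/-- hence the rank of `θ ↦ θ ∧ v` on `Λ^m` is invariant under such automorphisms: `rank(∧ φ(v) ∣ Λ^m) = rank(∧ v ∣ Λ^m)`.
[cite: BourbakiAlgebre1a3, Ch. III §7 no. 1] -/
lemma finrank_range_wedge_algEquiv (φ : HT K (In N) ≃ₐ[K] HT K (In N)) (π : Equiv.Perm (In N))
    (hφ : ∀ i, φ (gx K i) = gx K (π i)) (m : ℕ) (v : HT K (In N)) :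
    Module.finrank K (LinearMap.range (wedge K N m (φ v))) = Module.finrank K (LinearMap.range (wedge K N m v)) := by
  have h : LinearMap.mulRight K (φ v) ∘ₗ φ.toLinearMap = φ.toLinearMap ∘ₗ LinearMap.mulRight K v := by
    refine LinearMap.ext fun θ => ?_
    simp only [LinearMap.coe_comp, Function.comp_apply, LinearMap.mulRight_apply, AlgEquiv.toLinearMap_apply, map_mul]
  rw [range_wedge, range_wedge]
  calc Module.finrank K ↥((Hom K (In N) Finset.univ m).map (LinearMap.mulRight K (φ v)))
      = Module.finrank K ↥(((Hom K (In N) Finset.univ m).map φ.toLinearMap).map (LinearMap.mulRight K (φ v))) := by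
        rw [map_algEquiv_Hom_univ K φ π hφ m]
    _ = Module.finrank K ↥(((Hom K (In N) Finset.univ m).map (LinearMap.mulRight K v)).map φ.toLinearMap) := by
        rw [← Submodule.map_comp, h, Submodule.map_comp]
    _ = Module.finrank K ↥((Hom K (In N) Finset.univ m).map (LinearMap.mulRight K v)) :=
        LinearEquiv.finrank_map_eq φ.toLinearEquiv _

/-- the range of `θ ↦ θ ∧ (s·v)` is that of `θ ↦ θ ∧ v` for a unit `s`. -/
lemma range_wedge_smul {s : K} (hs : s ≠ 0) (m : ℕ) (v : HT K (In N)) :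
    LinearMap.range (wedge K N m (s • v)) = LinearMap.range (wedge K N m v) := by
  have h : wedge K N m (s • v) = s • wedge K N m v := by
    refine LinearMap.ext fun θ => ?_
    simp only [wedge, LinearMap.coe_comp, Function.comp_apply, Submodule.coe_subtype, LinearMap.mulRight_apply,
      LinearMap.smul_apply, mul_smul_comm]
  rw [h, LinearMap.range_smul _ _ hs]

/-- the value of the half-swap `finAddFlip` on `Fin (n + n)`: `c ↦ c + n` below `n`, `c ↦ c − n` from `n` on. -/
lemma val_finAddFlip_nn {n : ℕ} (c : Fin (n + n)) :
    (((finAddFlip : Equiv.Perm (Fin (n + n))) c : Fin (n + n)) : ℕ) = if (c : ℕ) < n then (c : ℕ) + n else (c : ℕ) - n := by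
  obtain ⟨k, hk⟩ := c
  by_cases h : k < n
  · rw [finAddFlip_apply_mk_left h, if_pos h]
    exact Nat.add_comm n k
  · rw [finAddFlip_apply_mk_right (not_lt.mp h) hk, if_neg h]

/-- the half-swap of the `2n` pairs carries the block `G₊ = Dm n` (the first `n` pairs) onto `G₋ = Gm n` (the last `n` pairs). -/
lemma map_dup_finAddFlip_Dm (n : ℕ) :
    (Dm (n + n) n).map (dup (n + n) (finAddFlip : Equiv.Perm (Fin (n + n)))).toEmbedding = Gm (n + n) n := by
  apply Finset.eq_of_subset_of_card_le
  · intro j hj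
    rw [Finset.mem_map] at hj
    obtain ⟨i, hi, rfl⟩ := hj
    rw [mem_Dm_iff] at hi
    rw [Equiv.toEmbedding_apply, mem_Gm_iff, pr_dup, val_finAddFlip_nn, if_pos hi]
    omega
  · rw [Finset.card_map, card_Dm (Nat.le_add_right n n), card_Gm (Nat.le_add_right n n)]
    omega

/-- the half-swap carries the `b`-side class `f + b·w₋` to a UNIT multiple of an `a`-side class `f + a′·w₊`, `a′ ≠ 0`. -/
lemma σκ_vW_low (n : ℕ) (q : ℕ → K) (b : K) :
    ∃ a' : K, (b ≠ 0 → a' ≠ 0) ∧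
      σκ K (n + n) (finAddFlip : Equiv.Perm (Fin (n + n))) (vW K (n + n) n q 0 b) =
        sgn (K := K) (finAddFlip : Equiv.Perm (Fin (n + n))) • vW1 K (n + n) n q a' := by
  set κ : Equiv.Perm (Fin (n + n)) := finAddFlip with hκ
  obtain ⟨c, hc, hB⟩ := algEquiv_B K (σκ K (n + n) κ) (dup (n + n) κ) (σκ_gx K κ) (Dm (n + n) n)
  rw [hκ, map_dup_finAddFlip_Dm, ← hκ] at hB
  have hs : sgn (K := K) κ ≠ 0 := sgn_ne_zero (K := K) κ
  refine ⟨(sgn (K := K) κ)⁻¹ * (b * c), fun hb => mul_ne_zero (inv_ne_zero hs) (mul_ne_zero hb hc), ?_⟩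
  rw [vW1, smul_add, smul_smul, mul_inv_cancel_left₀ hs, vW, zero_smul, add_zero, map_add, map_smul, σκ_f, hB, smul_smul]

/-- **ONE-SIDED THEOREM R, `b`-SIDE, IN THE MODEL** (Weil type `(n,n)`, `v = f + b·w₋`, `b ≠ 0`, `m + 1 ≤ n`, every `q`, every field):
`finrank range(∧v ∣ Λ^m) + C(n,m)·r_m = C(2n,m) + C(2n,m)·r_m` — th-7's `a`-side `weilRank_nn_one` carried by the pair half-swap.
[cite: BuchweitzFlenner2008HH, Prop. 6.4.4] -/
theorem weilRank_nn_low {n m : ℕ} (hmn : m + 1 ≤ n) (q : ℕ → K) {b : K} (hb : b ≠ 0) :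
    Module.finrank K (LinearMap.range (wedge K (n + n) m (vW K (n + n) n q 0 b))) +
        n.choose m * (hankel1 K (n + n) m q).rank =
      (n + n).choose m + (n + n).choose m * (hankel1 K (n + n) m q).rank := by
  obtain ⟨a', ha', hv⟩ := σκ_vW_low K n q b
  rw [← finrank_range_wedge_algEquiv K (σκ K (n + n) (finAddFlip : Equiv.Perm (Fin (n + n))))
    (dup (n + n) (finAddFlip : Equiv.Perm (Fin (n + n)))) (σκ_gx K _) m, hv,
    range_wedge_smul K (sgn_ne_zero (K := K) _)]
  exact weilRank_nn_one K hmn q (ha' hb)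

/-- **ONE-SIDED THEOREM R, `b`-SIDE, MIRROR DEGREES** (`m + m′ = 2n`, `m′ + 1 ≤ n`, `b ≠ 0`):
`finrank range(∧v ∣ Λ^m) + C(n,m′)·r_{m′} = C(2n,m′) + C(2n,m′)·r_{m′}`. [cite: BuchweitzFlenner2008HH, Prop. 6.4.4] -/
theorem weilRank_nn_low_dual {n m m' : ℕ} (hmn : m' + 1 ≤ n) (hmm : m + m' = n + n) (q : ℕ → K) {b : K} (hb : b ≠ 0) :
    Module.finrank K (LinearMap.range (wedge K (n + n) m (vW K (n + n) n q 0 b))) +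
        n.choose m' * (hankel1 K (n + n) m' q).rank =
      (n + n).choose m' + (n + n).choose m' * (hankel1 K (n + n) m' q).rank := by
  rw [finrank_range_wedge_dual K (n := n + n) (d := n + n) (m := m) (m' := m') (by omega) (vW_nn_mem_Hom K n q 0 b)]
  exact weilRank_nn_low K hmn q hb

/-- `vW q a 0` is the one-sided vector `vW1 q a`. -/
lemma vW_zero_right (p : ℕ) (q : ℕ → K) (a : K) : vW K N p q a 0 = vW1 K N p q a := by
  rw [vW, vW1, zero_smul, add_zero]

end Model

/-! ### 2. Carrier: the one-sided column of THEOREM R_f on p4's carrier of Weil type `(n,n)`, both sides, every degree -/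

section Carrier

open Summit.Ventures.HSemireg.WedgeBridge Summit.Ventures.HSemireg.WeilCarrier
open Summit.Ventures.HSemireg.Wedge.Hankel Summit.Ventures.HSemireg.Wedge.Weil Summit.Ventures.HSemireg.Wedge.WeilPurity

variable {K : Type*} [Field K] {n : ℕ} {V : Type*} [AddCommGroup V] [Module K V] (bV : Basis (Fin ((n + n) + (n + n))) K V)

/-- exact transport, `a`-side: `dim S_k(Ecl q (2n) + a·w₊)` is the model rank of `vW1 (2n) n q ((−1)^{n·n}·a)`.
[cite: BourbakiAlgebre1a3, Ch. III §11 no. 9] -/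
lemma finrank_S_eq_model_nn_one (q : ℕ → K) (a : K) (k : ℕ) :
    Module.finrank K (S K (Lsp bV) k (Ecl bV q (n + n) + a • wUp bV n)) =
      Module.finrank K (LinearMap.range
        (Summit.Ventures.HSemireg.Wedge.Hankel.wedge K (n + n) k (vW1 K (n + n) n q ((-1 : K) ^ (n * n) * a)))) := by
  have h := finrank_S_eq_model_nn bV q a 0 k
  rwa [zero_smul, add_zero, vW_zero_right] at h

/-- exact transport, `b`-side: `dim S_k(Ecl q (2n) + b·w₋)` is the model rank of `vW (2n) n q 0 b`.
[cite: BourbakiAlgebre1a3, Ch. III §11 no. 9] -/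
lemma finrank_S_eq_model_nn_low (q : ℕ → K) (b : K) (k : ℕ) :
    Module.finrank K (S K (Lsp bV) k (Ecl bV q (n + n) + b • wLow bV n)) =
      Module.finrank K (LinearMap.range
        (Summit.Ventures.HSemireg.Wedge.Hankel.wedge K (n + n) k (vW K (n + n) n q 0 b))) := by
  have h := finrank_S_eq_model_nn bV q 0 b k
  rwa [zero_smul, add_zero, mul_zero] at h

/-- **THEOREM R_f ONE-SIDED, `b`-SIDE, LOWER SIDE DEGREES ON THE CARRIER** (`m + 1 ≤ n`, `b ≠ 0`, every `q`, every field):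
`dim S_m(Ecl q (2n) + b·w₋) + C(n,m)·r_m = C(2n,m) + C(2n,m)·r_m` (the `a`-side is p4's `WeilCarrier.finrank_S_weil_nn_one`).
[cite: BuchweitzFlenner2008HH, Prop. 6.4.4] -/
theorem finrank_S_weil_nn_low {m : ℕ} (hmn : m + 1 ≤ n) (q : ℕ → K) {b : K} (hb : b ≠ 0) :
    Module.finrank K (S K (Lsp bV) m (Ecl bV q (n + n) + b • wLow bV n)) + n.choose m * (hankel1 K (n + n) m q).rank =
      (n + n).choose m + (n + n).choose m * (hankel1 K (n + n) m q).rank := by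
  rw [finrank_S_eq_model_nn_low]
  exact weilRank_nn_low K hmn q hb

/-- **THEOREM R_f ONE-SIDED, `b`-SIDE, UPPER SIDE DEGREES ON THE CARRIER** (`m + m′ = 2n`, `m′ + 1 ≤ n`, `b ≠ 0`):
`dim S_m(Ecl q (2n) + b·w₋) + C(n,m′)·r_{m′} = C(2n,m′) + C(2n,m′)·r_{m′}`. [cite: BuchweitzFlenner2008HH, Prop. 6.4.4] -/
theorem finrank_S_weil_nn_low_dual {m m' : ℕ} (hmn : m' + 1 ≤ n) (hmm : m + m' = n + n) (q : ℕ → K) {b : K} (hb : b ≠ 0) :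
    Module.finrank K (S K (Lsp bV) m (Ecl bV q (n + n) + b • wLow bV n)) + n.choose m' * (hankel1 K (n + n) m' q).rank =
      (n + n).choose m' + (n + n).choose m' * (hankel1 K (n + n) m' q).rank := by
  rw [finrank_S_eq_model_nn_low]
  exact weilRank_nn_low_dual K hmn hmm q hb

/-- **THEOREM R_f ONE-SIDED, `a`-SIDE, UPPER SIDE DEGREES ON THE CARRIER** (`m + m′ = 2n`, `m′ + 1 ≤ n`, `a ≠ 0`):
`dim S_m(Ecl q (2n) + a·w₊) + C(n,m′)·r_{m′} = C(2n,m′) + C(2n,m′)·r_{m′}` (th-7's `weilRank_nn_one_dual` transported).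
[cite: BuchweitzFlenner2008HH, Prop. 6.4.4] -/
theorem finrank_S_weil_nn_one_dual {m m' : ℕ} (hmn : m' + 1 ≤ n) (hmm : m + m' = n + n) (q : ℕ → K) {a : K} (ha : a ≠ 0) :
    Module.finrank K (S K (Lsp bV) m (Ecl bV q (n + n) + a • wUp bV n)) + n.choose m' * (hankel1 K (n + n) m' q).rank =
      (n + n).choose m' + (n + n).choose m' * (hankel1 K (n + n) m' q).rank := by
  have ha' : (-1 : K) ^ (n * n) * a ≠ 0 := mul_ne_zero (pow_ne_zero _ (neg_ne_zero.mpr one_ne_zero)) ha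
  rw [finrank_S_eq_model_nn_one]
  exact weilRank_nn_one_dual K n hmn hmm q ha'

/-- **THEOREM R_f ONE-SIDED, `a`-SIDE, MIDDLE DEGREE ON THE CARRIER** (`n ≥ 1`, `a ≠ 0`, every `q`, every field):
`dim S_n(Ecl q (2n) + a·w₊) + 2·r_n + C(2n,n) = C(2n,n)·r_n + 2·C(2n,n) + rank(H_n(q) Ω_n H_n(q))`, i.e.
`R_n = r_n(C(2n,n) − 2) + C(2n,n) + rank(H_n Ω_n H_n)` (th-7's `weilPurity_oneSided_b_zero` transported).
[cite: BuchweitzFlenner2008HH, Prop. 6.4.4] -/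
theorem finrank_S_weil_nn_one_middle (hn : 1 ≤ n) (q : ℕ → K) {a : K} (ha : a ≠ 0) :
    Module.finrank K (S K (Lsp bV) n (Ecl bV q (n + n) + a • wUp bV n)) +
        2 * (hankel1 K (n + n) n q).rank + (n + n).choose n =
      (n + n).choose n * (hankel1 K (n + n) n q).rank + ((n + n).choose n + (n + n).choose n) +
        (Hsq K n q * Omega K n * Hsq K n q).rank := by
  have ha' : (-1 : K) ^ (n * n) * a ≠ 0 := mul_ne_zero (pow_ne_zero _ (neg_ne_zero.mpr one_ne_zero)) ha
  have h := finrank_S_eq_model_nn bV q a 0 n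
  rw [zero_smul, add_zero] at h
  rw [h]
  exact weilPurity_oneSided_b_zero K hn q ha'

/-- **THEOREM R_f ONE-SIDED, `b`-SIDE, MIDDLE DEGREE ON THE CARRIER** (`n ≥ 1`, `b ≠ 0`, every `q`, every field):
`dim S_n(Ecl q (2n) + b·w₋) + 2·r_n + C(2n,n) = C(2n,n)·r_n + 2·C(2n,n) + rank(H_n(q) Ω_n H_n(q))`
(th-7's `weilPurity_oneSided_a_zero` transported). [cite: BuchweitzFlenner2008HH, Prop. 6.4.4] -/
theorem finrank_S_weil_nn_low_middle (hn : 1 ≤ n) (q : ℕ → K) {b : K} (hb : b ≠ 0) :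
    Module.finrank K (S K (Lsp bV) n (Ecl bV q (n + n) + b • wLow bV n)) +
        2 * (hankel1 K (n + n) n q).rank + (n + n).choose n =
      (n + n).choose n * (hankel1 K (n + n) n q).rank + ((n + n).choose n + (n + n).choose n) +
        (Hsq K n q * Omega K n * Hsq K n q).rank := by
  rw [finrank_S_eq_model_nn_low]
  exact weilPurity_oneSided_a_zero K hn q hb

end Carrier

end Summit.Ventures.HSemireg.Mod4Carrier
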